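import Mathlib.CategoryTheory.Quotient
import Literature.AlgebraicGeometry.Frobenioids.UnitTrivializationFrobenioid
import Literature.AlgebraicGeometry.Frobenioids.IsotropicFrobenioid
import Literature.AlgebraicGeometry.Frobenioids.IsotropicSubcategory
import Literature.AlgebraicGeometry.Frobenioids.ElementaryPreFrobenioid
import Literature.AlgebraicGeometry.Frobenioids.CoAngular
import HarnessLib

/-!
# Frobenioids I, Proposition 3.3 (iv): the functor `C^un-tr → F_Φ` and the first properties of the
# unit-trivialisation `C^un-tr` of a Frobenioid

Mochizuki, *The geometry of Frobenioids I: the general theory*, Kyushu J. Math. **62** (2008)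
293–400, Def. 3.1 (iv) p. 57, Prop. 3.3 (ii)–(iv) pp. 59–60 [cite: MochizukiFrdI2008, Prop. 3.3 (iv) p.60]:
"(iv) The functor `C^istr → F_Φ` factors naturally through `C^un-tr`, hence determines a functor
`C^un-tr → F_Φ` which is faithful and essentially surjective; moreover, this functor determines a
natural structure of Frobenioid on `C^un-tr`, with respect to which `C^un-tr` is of isotropic and
unit-trivial type. Finally, an arrow of `C^un-tr` is a(n) morphism of Frobenius type (respectively,
pre-step; base-isomorphism; isomorphism; pull-back morphism; isometry; co-angular morphism;
LB-invertible morphism; morphism of a given Frobenius degree) if and only if it arises from such an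
arrow of `C^istr`."

The cell types `C^un-tr` as the quotient category `PreFrobenioidData.Untr S = Quotient S.UnitEquiv` of
`C^istr` by unit-equivalence (seat abc-iut-L1-t3, `BaseCategoryTheoreticityDefs.lean`), with the
factorisation/faithfulness clauses typed as `Prop33iv` and DISCHARGED (seats abc-iut-L1-t13/L1-d1:
`FrdI.Prop33ii_holds`, `prop33iv_holds`). This file CONSTRUCTS, for a Frobenioid `F : C → F_Φ` (found's
`PreFrobenioid.IsFrobenioid`) with §3–§4 operations `S = ofFunctor Φ F`, the functor of the first
sentence — `PreFrobenioid.untrFunctor hF : S.Untr ⥤ F_Φ` (`Quotient.lift` of `C^istr ↪ C → F_Φ`, well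
defined by Prop. 3.3 (ii)) — and proves: the factorisation `toUntr ⋙ untrFunctor = istrι ⋙ F`
(`toUntr_comp_untrFunctor`); faithfulness (`untrFunctor_faithful`); Prop. 3.3 (ii) in functor form
(`toUntr_map_eq_iff`); `C^un-tr` is totally epimorphic and connected; the "isotropic and unit-trivial
type" clause with respect to `untrFunctor` (`isOfIsotropicType_untr`, `isUnitTrivial_untr`); and the
invariant-level part of the final dictionary for a representative `α` of a class `[α]` (degree,
isometry, base-isomorphism, pre-step, isomorphism, co-angular — every arrow of `C^un-tr` is
co-angular —, LB-invertible, Frobenius type). The Frobenioid AXIOMS Def. 1.3 (i)–(vii) for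
`untrFunctor`, the pull-back clause of the dictionary, the essential surjectivity onto `F_Φ` and the
birationalization of `C^un-tr` follow in sibling files (construction row «C^un-tr is a Frobenioid +
(C^un-tr)^birat», seat abc-iut-L1-d5, L1-lead R53 (D); input of [FrdI] Prop. 4.8 (iii), seat
abc-iut-L6-t20). No statement of the paper is strengthened;
nothing here bears on [IUTchIII] Cor. 3.12.
-/

namespace Literature.AlgebraicGeometry.Frobenioids

open CategoryTheory Opposite

universe w v v' u u'

namespace PreFrobenioid

variable {D : Type u} [Category.{v} D] {Φ : Dᵒᵖ ⥤ CommMonCat.{w}} {C : Type u'}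
  [Category.{v'} C] {F : C ⥤ ElemFrobenioid Φ}

open PreFrobenioidData (ofFunctor)

/-! ### The functor `C^un-tr → F_Φ` -/

/-- **Prop. 3.3 (iv), the functor `C^un-tr → F_Φ`**: "The functor `C^istr → F_Φ` factors naturally
through `C^un-tr`, hence determines a functor `C^un-tr → F_Φ`" — the functor induced on the quotient
`C^un-tr = C^istr/≈^{O^×}` by `C^istr ↪ C → F_Φ`, well defined because unit-equivalent arrows have the
same image in `F_Φ` (Prop. 3.3 (ii)). [cite: MochizukiFrdI2008, Prop. 3.3 (iv) p.60] -/
noncomputable def untrFunctor (hF : IsFrobenioid F) : (ofFunctor Φ F).Untr ⥤ ElemFrobenioid Φ :=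
  CategoryTheory.Quotient.lift (ofFunctor Φ F).UnitEquiv ((ofFunctor Φ F).istrι ⋙ F)
    (fun _ _ α₁ α₂ e => by
      obtain ⟨hdeg, hdiv, hbase⟩ := unitEquiv_invariants hF α₁ α₂ e
      exact ElemFrobenioid.Hom.ext hbase hdiv hdeg)

variable {hF : IsFrobenioid F}

/-- The factorisation `C^istr → C^un-tr → F_Φ = C^istr ↪ C → F_Φ` (on the nose).
[cite: MochizukiFrdI2008, Prop. 3.3 (iv) p.60] -/
theorem toUntr_comp_untrFunctor :
    (ofFunctor Φ F).toUntr ⋙ untrFunctor hF = (ofFunctor Φ F).istrι ⋙ F :=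
  Quotient.lift_spec _ _ _

/-- `C^un-tr → F_Φ` on objects. [cite: MochizukiFrdI2008, Prop. 3.3 (iv) p.60] -/
theorem untrFunctor_obj (X : (ofFunctor Φ F).Untr) : (untrFunctor hF).obj X = F.obj X.as.obj := rfl

/-- `C^un-tr → F_Φ` on the class of an arrow `α` of `C^istr`: the image of `α` in `F_Φ`.
[cite: MochizukiFrdI2008, Prop. 3.3 (iv) p.60] -/
theorem untrFunctor_map_toUntr {A B : (ofFunctor Φ F).Istr} (α : A ⟶ B) :
    (untrFunctor hF).map ((ofFunctor Φ F).toUntr.map α) = F.map α.hom := rfl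

/-- Frobenius degree of a class = Frobenius degree of any representative.
[cite: MochizukiFrdI2008, Prop. 3.3 (iv) p.60] -/
theorem degFr_toUntr {A B : (ofFunctor Φ F).Istr} (α : A ⟶ B) :
    degFr (untrFunctor hF) ((ofFunctor Φ F).toUntr.map α) = degFr F α.hom := rfl

/-- Base of a class = base of any representative. [cite: MochizukiFrdI2008, Prop. 3.3 (iv) p.60] -/
theorem base_toUntr {A B : (ofFunctor Φ F).Istr} (α : A ⟶ B) :
    Base (untrFunctor hF) ((ofFunctor Φ F).toUntr.map α) = Base F α.hom := rfl

/-- Zero divisor of a class = zero divisor of any representative. [cite: MochizukiFrdI2008, Prop. 3.3 (iv) p.60] -/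
theorem div_toUntr {A B : (ofFunctor Φ F).Istr} (α : A ⟶ B) :
    Div (untrFunctor hF) ((ofFunctor Φ F).toUntr.map α) = Div F α.hom := rfl

/-! ### Prop. 3.3 (ii) in functor form, faithfulness -/

/-- **Prop. 3.3 (ii)** for the quotient: two arrows of `C^istr` have the same class in `C^un-tr` iff they
have the same image in `F_Φ` ("unit-equivalent iff they map to the same morphism of `F_Φ`").
[cite: MochizukiFrdI2008, Prop. 3.3 (ii) p.59] -/
theorem toUntr_map_eq_iff (hF : IsFrobenioid F) {A B : (ofFunctor Φ F).Istr} (α₁ α₂ : A ⟶ B) :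
    (ofFunctor Φ F).toUntr.map α₁ = (ofFunctor Φ F).toUntr.map α₂ ↔ F.map α₁.hom = F.map α₂.hom := by
  refine ⟨fun h => ?_, fun h => ?_⟩
  · have h' := congrArg (untrFunctor hF).map h
    exact h'
  · exact (prop33iv_holds hF).2 α₁ α₂ (congrArg ElemFrobenioid.Hom.degFr h)
      (congrArg ElemFrobenioid.Hom.div h) (congrArg ElemFrobenioid.Hom.base h)

/-- **Prop. 3.3 (iv)**: `C^un-tr → F_Φ` is faithful. [cite: MochizukiFrdI2008, Prop. 3.3 (iv) p.60] -/
theorem untrFunctor_faithful (hF : IsFrobenioid F) : (untrFunctor hF).Faithful := by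
  refine ⟨fun {X Y} g₁ g₂ h => ?_⟩
  obtain ⟨α₁, rfl⟩ := (ofFunctor Φ F).toUntr.map_surjective g₁
  obtain ⟨α₂, rfl⟩ := (ofFunctor Φ F).toUntr.map_surjective g₂
  exact (toUntr_map_eq_iff hF α₁ α₂).mpr h

/-! ### `C^un-tr` is totally epimorphic and connected -/

/-- `F_Φ` is totally epimorphic for the divisor monoid of a Frobenioid (Prop. 1.5, first step).
[cite: MochizukiFrdI2008, Prop. 1.5 p.27] -/
theorem isTotallyEpimorphic_elem (hF : IsFrobenioid F) : IsTotallyEpimorphic (ElemFrobenioid Φ) :=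
  ElemFrobenioid.isTotallyEpimorphic hF.isPreFrobenioid.isTotallyEpimorphic_base
    (fun A => (hF.isPreFrobenioid.isDivisorial A).isPreDivisorial.isIntegral)
    (fun α => (hF.isPreFrobenioid.isMonoidOn.isCharInjective α).1)

/-- `C^un-tr` is totally epimorphic (a faithful functor into the totally epimorphic `F_Φ`).
[cite: MochizukiFrdI2008, Prop. 3.3 (iv) p.60] -/
theorem isTotallyEpimorphic_untr (hF : IsFrobenioid F) : IsTotallyEpimorphic (ofFunctor Φ F).Untr := by
  haveI := untrFunctor_faithful hF
  refine ⟨fun {X Y} g => ⟨fun {Z} h₁ h₂ e => ?_⟩⟩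
  haveI := (isTotallyEpimorphic_elem hF).epi ((untrFunctor hF).map g)
  apply (untrFunctor hF).map_injective
  rw [← cancel_epi ((untrFunctor hF).map g), ← Functor.map_comp, ← Functor.map_comp, e]

/-- `C^un-tr` is connected (as `C^istr` is, `C^istr → C^un-tr` being the identity on objects).
[cite: MochizukiFrdI2008, Prop. 3.3 (iv) p.60] -/
theorem isGraphConnected_untr (hF : IsFrobenioid F) : IsGraphConnected (ofFunctor Φ F).Untr := by
  haveI : (ObjectProperty.ιOfLE (fun A (h : (ofFunctor Φ F).isotropicObjects A) =>
      (PreFrobenioidData.ofFunctor_isIsotropic F A).mp h)).IsEquivalence :=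
    (ObjectProperty.isEquivalence_ιOfLE_iff _).mpr (fun X hX =>
      ObjectProperty.le_isoClosure _ _ ((PreFrobenioidData.ofFunctor_isIsotropic F X).mpr hX))
  obtain ⟨⟨A⟩, hz⟩ := isGraphConnected_istr hF
  let e := (ObjectProperty.ιOfLE (fun A (h : (ofFunctor Φ F).isotropicObjects A) =>
      (PreFrobenioidData.ofFunctor_isIsotropic F A).mp h)).asEquivalence
  refine ⟨⟨(ofFunctor Φ F).toUntr.obj (e.inverse.obj A)⟩, fun X Y => ?_⟩
  have hXY : Zigzag (e.inverse.obj (e.functor.obj X.as)) (e.inverse.obj (e.functor.obj Y.as)) :=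
    zigzag_obj_of_zigzag e.inverse (hz _ _)
  have hX : Zigzag X.as (e.inverse.obj (e.functor.obj X.as)) :=
    Zigzag.of_hom (e.unitIso.hom.app X.as)
  have hY : Zigzag (e.inverse.obj (e.functor.obj Y.as)) Y.as :=
    Zigzag.of_hom (e.unitIso.inv.app Y.as)
  exact zigzag_obj_of_zigzag (ofFunctor Φ F).toUntr ((hX.trans hXY).trans hY)

/-- `C^un-tr → F_Φ` is a pre-Frobenioid (the standing hypotheses of Def. 1.3 for the Frobenioid
structure asserted in Prop. 3.3 (iv): `Φ` is the divisorial monoid of `C`, `D` its base, and `C^un-tr`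
is connected and totally epimorphic). [cite: MochizukiFrdI2008, Prop. 3.3 (iv) p.60] -/
theorem isPreFrobenioid_untr (hF : IsFrobenioid F) : IsPreFrobenioid Φ (untrFunctor hF) where
  isMonoidOn := hF.isPreFrobenioid.isMonoidOn
  isDivisorial := hF.isPreFrobenioid.isDivisorial
  isGraphConnected_base := hF.isPreFrobenioid.isGraphConnected_base
  isTotallyEpimorphic_base := hF.isPreFrobenioid.isTotallyEpimorphic_base
  isGraphConnected := isGraphConnected_untr hF
  isTotallyEpimorphic := isTotallyEpimorphic_untr hF

/-! ### The dictionary `C^istr ⇆ C^un-tr` on invariants (Prop. 3.3 (iv), final sentence) -/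

/-- Linear. [cite: MochizukiFrdI2008, Prop. 3.3 (iv) p.60] -/
theorem isLinear_toUntr_iff {A B : (ofFunctor Φ F).Istr} (α : A ⟶ B) :
    IsLinear (untrFunctor hF) ((ofFunctor Φ F).toUntr.map α) ↔ IsLinear F α.hom := Iff.rfl

/-- "morphism of a given Frobenius degree". [cite: MochizukiFrdI2008, Prop. 3.3 (iv) p.60] -/
theorem degFr_toUntr_eq_iff {A B : (ofFunctor Φ F).Istr} (α : A ⟶ B) (n : ℕ+) :
    degFr (untrFunctor hF) ((ofFunctor Φ F).toUntr.map α) = n ↔ degFr F α.hom = n := Iff.rfl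

/-- "isometry". [cite: MochizukiFrdI2008, Prop. 3.3 (iv) p.60] -/
theorem isIsometry_toUntr_iff {A B : (ofFunctor Φ F).Istr} (α : A ⟶ B) :
    IsIsometry (untrFunctor hF) ((ofFunctor Φ F).toUntr.map α) ↔ IsIsometry F α.hom := Iff.rfl

/-- "base-isomorphism". [cite: MochizukiFrdI2008, Prop. 3.3 (iv) p.60] -/
theorem isBaseIso_toUntr_iff {A B : (ofFunctor Φ F).Istr} (α : A ⟶ B) :
    IsBaseIso (untrFunctor hF) ((ofFunctor Φ F).toUntr.map α) ↔ IsBaseIso F α.hom := Iff.rfl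

/-- "pre-step". [cite: MochizukiFrdI2008, Prop. 3.3 (iv) p.60] -/
theorem isPreStep_toUntr_iff {A B : (ofFunctor Φ F).Istr} (α : A ⟶ B) :
    IsPreStep (untrFunctor hF) ((ofFunctor Φ F).toUntr.map α) ↔ IsPreStep F α.hom := Iff.rfl

/-- Base-identity endomorphisms. [cite: MochizukiFrdI2008, Prop. 3.3 (iv) p.60] -/
theorem isBaseIdentity_toUntr_iff {A : (ofFunctor Φ F).Istr} (α : A ⟶ A) :
    IsBaseIdentity (untrFunctor hF) ((ofFunctor Φ F).toUntr.map α) ↔ IsBaseIdentity F α.hom := Iff.rfl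

/-- An arrow of `C^istr` whose image in `F_Φ` is that of an identity is an isomorphism (an isometric
pre-step out of an isotropic object). [cite: MochizukiFrdI2008, Def. 1.2 (iv) p.23] -/
theorem isIso_istr_of_map_eq_id {A : (ofFunctor Φ F).Istr} (α : A ⟶ A)
    (h : F.map α.hom = F.map (𝟙 A.obj)) : IsIso α := by
  have hA : IsIsotropic F A.obj := (PreFrobenioidData.ofFunctor_isIsotropic F A.obj).mp A.property
  have hdeg : degFr F α.hom = 1 := (congrArg ElemFrobenioid.Hom.degFr h).trans (degFr_id F A.obj)
  have hdiv : Div F α.hom = 1 := (congrArg ElemFrobenioid.Hom.div h).trans (div_id F A.obj)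
  have hbase : Base F α.hom = 𝟙 _ := (congrArg ElemFrobenioid.Hom.base h).trans (base_id F A.obj)
  have hiso : IsIso α.hom := hA α.hom hdiv ⟨hdeg, by
    change IsIso (Base F α.hom); rw [hbase]; infer_instance⟩
  exact (ObjectProperty.isIso_hom_iff α).mp hiso

/-- "isomorphism": the class `[α]` of `α ∈ Arr(C^istr)` is an isomorphism of `C^un-tr` iff `α` is an
isomorphism (`⇒`: an inverse class `[β]` gives `α ≫ β ≈ id`, `β ≫ α ≈ id`, i.e. both composites are
isometric pre-steps out of isotropic objects, hence isomorphisms). [cite: MochizukiFrdI2008, Prop. 3.3 (iv) p.60] -/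
theorem isIso_toUntr_iff (hF : IsFrobenioid F) {A B : (ofFunctor Φ F).Istr} (α : A ⟶ B) :
    IsIso ((ofFunctor Φ F).toUntr.map α) ↔ IsIso α := by
  refine ⟨fun hiso => ?_, fun _ => inferInstance⟩
  obtain ⟨β, hβ⟩ := (ofFunctor Φ F).toUntr.map_surjective (inv ((ofFunctor Φ F).toUntr.map α))
  have h₁ : (ofFunctor Φ F).toUntr.map (α ≫ β) = (ofFunctor Φ F).toUntr.map (𝟙 A) := by
    rw [Functor.map_comp, hβ, IsIso.hom_inv_id, CategoryTheory.Functor.map_id]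
  have h₂ : (ofFunctor Φ F).toUntr.map (β ≫ α) = (ofFunctor Φ F).toUntr.map (𝟙 B) := by
    rw [Functor.map_comp, hβ, IsIso.inv_hom_id, CategoryTheory.Functor.map_id]
  haveI : IsIso (α ≫ β) :=
    isIso_istr_of_map_eq_id (α ≫ β) ((toUntr_map_eq_iff hF _ _).mp h₁)
  haveI : IsIso (β ≫ α) :=
    isIso_istr_of_map_eq_id (β ≫ α) ((toUntr_map_eq_iff hF _ _).mp h₂)
  haveI : IsSplitMono α := IsSplitMono.mk' ⟨β ≫ inv (α ≫ β), by rw [← Category.assoc, IsIso.hom_inv_id]⟩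
  haveI : Epi α := by
    haveI : IsSplitEpi α := IsSplitEpi.mk' ⟨inv (β ≫ α) ≫ β, by rw [Category.assoc, IsIso.inv_hom_id]⟩
    infer_instance
  exact isIso_of_epi_of_isSplitMono α

/-- Every isometric pre-step of `C^un-tr` is an isomorphism (a representative is an isometric pre-step
of `C^istr` out of an isotropic object). [cite: MochizukiFrdI2008, Prop. 3.3 (iv) p.60] -/
theorem isIso_of_isIsometry_of_isPreStep_untr (hF : IsFrobenioid F) {X Y : (ofFunctor Φ F).Untr}
    (β : X ⟶ Y) (h₁ : IsIsometry (untrFunctor hF) β) (h₂ : IsPreStep (untrFunctor hF) β) : IsIso β := by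
  obtain ⟨b, rfl⟩ := (ofFunctor Φ F).toUntr.map_surjective β
  have hX : IsIsotropic F X.as.obj := (PreFrobenioidData.ofFunctor_isIsotropic F X.as.obj).mp X.as.property
  haveI : IsIso b.hom := hX b.hom h₁ h₂
  haveI : IsIso b := (ObjectProperty.isIso_hom_iff b).mp inferInstance
  exact Functor.map_isIso (ofFunctor Φ F).toUntr b

/-- **"with respect to which `C^un-tr` is of isotropic type"**. [cite: MochizukiFrdI2008, Prop. 3.3 (iv) p.60] -/
theorem isOfIsotropicType_untr (hF : IsFrobenioid F) : IsOfIsotropicType (untrFunctor hF) :=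
  fun _ _ β h₁ h₂ => isIso_of_isIsometry_of_isPreStep_untr hF β h₁ h₂

/-- "co-angular morphism": EVERY arrow of `C^un-tr` is co-angular (its isometric pre-steps being
isomorphisms). [cite: MochizukiFrdI2008, Prop. 3.3 (iv) p.60] -/
theorem isCoAngular_untr (hF : IsFrobenioid F) {X Y : (ofFunctor Φ F).Untr} (g : X ⟶ Y) :
    IsCoAngular (untrFunctor hF) g :=
  fun _ _ _ β _ _ _ hβ hβ' _ => isIso_of_isIsometry_of_isPreStep_untr hF β hβ hβ'

/-- Every arrow of `C^istr` is co-angular (same reason: `C^istr` is of isotropic type).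
[cite: MochizukiFrdI2008, Prop. 1.9 (v) p.32] -/
theorem isCoAngular_istr' {A B : Istr F} (α : A ⟶ B) :
    IsCoAngular (istrFunctor F) α :=
  fun _ _ _ β _ _ _ hβ hβ' _ => isIsotropic_istr _ β hβ hβ'

/-- "LB-invertible morphism": `[α]` is LB-invertible iff `α` is an isometry (co-angularity being
automatic on both sides). [cite: MochizukiFrdI2008, Prop. 3.3 (iv) p.60] -/
theorem isLBInvertible_toUntr_iff (hF : IsFrobenioid F) {A B : (ofFunctor Φ F).Istr} (α : A ⟶ B) :
    IsLBInvertible (untrFunctor hF) ((ofFunctor Φ F).toUntr.map α) ↔ IsIsometry F α.hom :=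
  ⟨fun h => h.2, fun h => ⟨isCoAngular_untr hF _, h⟩⟩

/-- "morphism of Frobenius type": `[α]` is of Frobenius type in `C^un-tr` iff `α` is an isometric
base-isomorphism of `C`, i.e. (`α` being co-angular in `C` as an arrow out of an isotropic object,
Def. 1.3 (vii)(b)) iff `α` is of Frobenius type. [cite: MochizukiFrdI2008, Prop. 3.3 (iv) p.60] -/
theorem isFrobeniusType_toUntr_iff (hF : IsFrobenioid F) {A B : (ofFunctor Φ F).Istr} (α : A ⟶ B) :
    IsFrobeniusType (untrFunctor hF) ((ofFunctor Φ F).toUntr.map α) ↔ IsFrobeniusType F α.hom := by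
  refine ⟨fun h => ⟨⟨?_, h.1.2⟩, h.2⟩, fun h => ⟨⟨isCoAngular_untr hF _, h.1.2⟩, h.2⟩⟩
  -- an arrow of `C` out of an isotropic object is co-angular
  have hA : IsIsotropic F A.obj := (PreFrobenioidData.ofFunctor_isIsotropic F A.obj).mp A.property
  intro X' Y' γ β α' _ _ hβ hβ' _
  exact (hF.vii_b γ hA) β hβ hβ'

/-! ### Unit-trivial type -/

/-- **"with respect to which `C^un-tr` is of … unit-trivial type"**: a unit `u ∈ O^×(X)` of `C^un-tr`
is the class of a base-identity linear automorphism `a` of `C^istr`; being an isomorphism, `a` is an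
isometry, so `a` and `id` have the same image in `F_Φ` and `u = [a] = [id] = 1` (Prop. 3.3 (ii)).
[cite: MochizukiFrdI2008, Prop. 3.3 (iv) p.60] -/
theorem isUnitTrivial_untr (hF : IsFrobenioid F) (X : (ofFunctor Φ F).Untr) :
    IsUnitTrivial (untrFunctor hF) X := by
  intro u hu
  obtain ⟨a, ha⟩ := (ofFunctor Φ F).toUntr.map_surjective (X := X.as) (Y := X.as) u.hom
  haveI : IsIso ((ofFunctor Φ F).toUntr.map a) := by rw [ha]; infer_instance
  haveI : IsIso a := (isIso_toUntr_iff hF a).mp inferInstance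
  haveI : IsIso a.hom := inferInstance
  have hbase : Base F a.hom = 𝟙 _ := by
    have h := hu.1
    rw [← ha] at h
    exact h
  have hdeg : degFr F a.hom = 1 := by
    have h := hu.2
    rw [← ha] at h
    exact h
  have hdiv : Div F a.hom = 1 := isIsometry_of_isIso F hF.isPreFrobenioid a.hom
  apply Iso.ext
  rw [← ha]
  change (ofFunctor Φ F).toUntr.map a = (ofFunctor Φ F).toUntr.map (𝟙 X.as)
  refine (toUntr_map_eq_iff hF a (𝟙 X.as)).mpr (ElemFrobenioid.Hom.ext ?_ ?_ ?_)
  · exact hbase.trans (base_id F X.as.obj).symm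
  · exact hdiv.trans (div_id F X.as.obj).symm
  · exact hdeg.trans (degFr_id F X.as.obj).symm

/-- `C^un-tr` is of unit-trivial type. [cite: MochizukiFrdI2008, Prop. 3.3 (iv) p.60] -/
theorem isOfUnitTrivialType_untr (hF : IsFrobenioid F) : IsOfType (IsUnitTrivial (untrFunctor hF)) :=
  fun X => isUnitTrivial_untr hF X

end PreFrobenioid

end Literature.AlgebraicGeometry.Frobenioids
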